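import Summits.AnomalousDissipation.AnomalousDissipation.Theorems.BaireTransferDenseLoudDesignerForcesErgodicModelDefs
import Summits.AnomalousDissipation.AnomalousDissipation.Theorems.BaireTransferDenseLoudDesignerForcesErgodicModelCoreV
import Literature.Analysis.FluidPDE.StokesTorusFrameResolvent

/-!
# Compactness of the model core `S ⁻¹' K_c` of a model frame (registered tools stub S6f of the crux
# `DenseLoudDesignerForces`, line ergodic-budget-selection-closing, block N, stmt-AnomalousDissipation-1143)

Summit-side plumbing for the smooth-model assembly (registered stub `stub_smoothModel`): for a `ModelFrame` `F`
(`…ErgodicModelDefs.lean`: the Stokes mode basis `F.b` with eigenvalues `F.m > 0`, `stokesOperatorH (Fin 3) = F.b.diagonalPMap F.m`,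
and the frame operator `F.S = (1 + A)^{-1/2}` pinned by `F.S (F.b i) = (1 + F.m i)^{-1/2} • F.b i`, injective), an NS phase `(K, φ)`
at `ν > 0` and a compact `K_c ⊆ φ_τ(K)` (`τ > 0`), the model core `Λ = F.S ⁻¹' K_c` is COMPACT in `H` and `F.S` maps it onto `K_c`.
Proof: the resolvent `R := F.S ∘ F.S` inverts `1 + A` on both sides — the landed Literature theorem
`Torus.stokes_resolvent_comp_self` (`Literature/Analysis/FluidPDE/StokesTorusFrameResolvent.lean`, from the action of `F.S` on the
eigenbasis) — and then the landed V-frame core theorem `stub_modelCoreCompactVTools` (`…ErgodicModelCoreV.lean`, N0h) applies verbatim.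

References: Constantin–Foias, *Navier–Stokes Equations* (1988) Ch. 4 ((4.11)–(4.13), `V = D(A^{1/2})`, compactness of `V ⊂ H`);
Robinson–Rodrigo–Sadowski, *The Three-Dimensional Navier–Stokes Equations* (CUP 2016) Thm 1.19, Thm 7.1–7.5.
-/

-- `Summit.<Summit>.<Problem>` is the tree's mandated summit-side namespace (CONVENTIONS §2); for this
-- single-conjunct summit the two coincide, so the duplicate is deliberate.
set_option linter.dupNamespace false

noncomputable section

open Set Function MeasureTheory Filter
open scoped InnerProductSpace RealInnerProductSpace

namespace Summit.AnomalousDissipation.AnomalousDissipation.Theorems.DenseLoudDesignerForces.Ergodic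

open Literature.Analysis.FunctionSpaces Literature.Analysis.FunctionSpaces.Torus
open Literature.Analysis.FluidPDE Literature.Analysis.FluidPDE.Torus

/-- **Tools stub S6f — compactness of the model core `Λ = S ⁻¹' K_c` of a model frame** (registered tools stub
`stub_modelCoreCompactFrameTools` of block N, crux stmt-AnomalousDissipation-1143, line `ergodic-budget-selection-closing`).
For an NS phase `(K, φ)` at `ν > 0`, a `ModelFrame` `F` and a compact `K_c ⊆ φ_τ(K)` (`τ > 0`): `F.S ⁻¹' K_c` is compact and
`F.S '' (F.S ⁻¹' K_c) = K_c`.  The resolvent `R := F.S ∘ F.S` satisfies `R v ∈ D(A)`, `R v + A (R v) = v` (`v ∈ H`) and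
`R (v + A v) = v` (`v ∈ D(A)`) for `A = stokesOperatorH (Fin 3) = F.b.diagonalPMap F.m` (`Torus.stokes_resolvent_comp_self`, from
`F.hA`, `F.hpos`, `F.hS`), so the landed `stub_modelCoreCompactVTools` (with `F.hSinj`) gives both conjuncts. [folklore] -/
theorem stub_modelCoreCompactFrameTools {ν : ℝ} {F₀ : (UnitAddTorus (Fin 3)) → (EuclideanSpace ℝ (Fin 3))} {K : Set Hsp}
    {φ : ℝ → Hsp → Hsp} (hν : 0 < ν) (hK : IsNSPhase ν F₀ K φ) (F : ModelFrame)
    {Kc : Set Hsp} (hKc : IsCompact Kc) {τ : ℝ} (hτ : 0 < τ) (hsub : Kc ⊆ φ τ '' K) :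
    IsCompact (F.S ⁻¹' Kc) ∧ F.S '' (F.S ⁻¹' Kc) = Kc := by
  -- the two resolvent identities of `R := F.S ∘ F.S` for the Stokes operator `A = F.b.diagonalPMap F.m`
  obtain ⟨hR, hR'⟩ := stokes_resolvent_comp_self F.b (fun i => (F.hpos i).le) F.hA F.hS
  -- the landed V-frame core theorem N0h
  have h := stub_modelCoreCompactVTools hν hK F.S (F.S.comp F.S) rfl F.hSinj hR hR' hKc hτ hsub
  exact ⟨h.1, h.2.1⟩

end Summit.AnomalousDissipation.AnomalousDissipation.Theorems.DenseLoudDesignerForces.Ergodic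

end
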